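import Literature.IUT.LogThetaLattice.TensorPackets
import HarnessLib

/-!
# [IUTchIII] Proposition 3.1 (i) / Remark 3.1.1 (i): the two typed SCHEMAS are false as kernel constants

S. Mochizuki, *Inter-universal Teichmüller theory III*, kurims manuscript (May 2020) of PRIMS **57**
(2021), §3, Proposition 3.1 (i) "(Ring Structures)" p. 93 and Remark 3.1.1 (i) pp. 93–94
[claim: Mochizuki2012, status: disputed] (D-0012 claim key; the content used below is undisputed
linear algebra over `ℚ`).

PROOF-ONLY companion of `TensorPackets.lean` (abc-iut-L6-t4).  Two `Prop`-valued definitions of that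
file are SCHEMAS whose universal closure over the constant's own binders is FALSE; this file records the
kernel refutations so that the abc-iut FACT-LIST rows carry a theorem instead of an audit word
(rows F-2124 and F-2128; R7 kernel type-audit of abc-iut-w5-d088 gen 2: the landed witnesses prove
INSTANCE forms only):

* `Remark311i_model 𝕜 L O kbar Okbar` ("the interface data `(L, O)` is abstractly isomorphic to the model
  data `(k̄, 𝒪_{k̄})`") quantifies over ARBITRARY integral structures `O`, `Okbar`: at
  `L = kbar = ℚ`, `O = ℤ`, `Okbar = ℚ` no `ℚ`-algebra automorphism matches them
  (`not_forall_remark311i_model`).  Instance form of record (PROVED):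
  `LogShellBridge.remark311i_model_holds` (file `LogShellIdentificationBridgeIntegers.lean`).
* `Prop31i_ringStructures' 𝕜 L` ("the tensor packet is a finite product of fields") lost its intended
  section instances `[Fintype A] [Fintype Vfib] [Module.Finite] [Algebra.IsSeparable]` (they are not
  referenced by the body; finding class G-BINDER-DROP, recorded in `TensorPacketsProofs.lean`), so the
  constant quantifies over ARBITRARY index types: at `A = PUnit`, `Vfib = ℕ`, `L α v = ℚ` the packet
  `⊗_{PUnit} (ℕ → ℚ)` has infinitely many idempotents `⊗ δ_n`, whereas a finite product of fields
  `Π_{i : ι} K_i` has at most `2^{|ι|}` (`not_forall_prop31i_ringStructures'`).  Instance form of record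
  (PROVED): `Prop31i_ringStructures'_of_field` (finite-dimensional separable fields).

No definitions; nothing here bears on the reading of [IUTchIII] Cor. 3.12 (in print the index sets are
finite and the integral structures are the given ones; this only aligns two kernel constants with their
witnesses).
-/

namespace Literature.IUT.LogThetaLattice

open PiTensorProduct

/-- **F-2128 — the schema `Remark311i_model` is false as typed** ([IUTchIII] Rmk. 3.1.1 (i), pp. 93–94,
typed with FREE integral structures on both sides): at `𝕜 = L α v = k̄_v = ℚ` (one capsule index, one
place), `O = ℤ ⊆ ℚ` and `Okbar = ℚ`, every `ℚ`-algebra isomorphism `e` has `e (1/2) ∈ Okbar` but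
`1/2 ∉ O`.  Instance form PROVED: `LogShellBridge.remark311i_model_holds`.
[claim: Mochizuki2012, status: disputed] -/
theorem not_forall_remark311i_model :
    ¬ ∀ (𝕜 : Type) [Field 𝕜] (A Vfib : Type) (L : A → Vfib → Type) [∀ α v, CommRing (L α v)]
        [∀ α v, Algebra 𝕜 (L α v)] (O : ∀ α v, Subring (L α v)) (kbar : Vfib → Type)
        [∀ v, Field (kbar v)] [∀ v, Algebra 𝕜 (kbar v)] (Okbar : ∀ v, Subring (kbar v)),
        Remark311i_model 𝕜 L O kbar Okbar := by
  intro h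
  obtain ⟨e, he⟩ :=
    h ℚ PUnit PUnit (fun _ _ => ℚ) (fun _ _ => ⊥) (fun _ => ℚ) (fun _ => ⊤) PUnit.unit PUnit.unit
  have h2 : (1 / 2 : ℚ) ∈ (⊥ : Subring ℚ) := (he (1 / 2 : ℚ)).mpr (Subring.mem_top _)
  obtain ⟨n, hn⟩ := Subring.mem_bot.mp h2
  have h1 : (2 : ℚ) * n = 1 := by rw [hn]; norm_num
  have h1' : (2 : ℤ) * n = 1 := by exact_mod_cast h1
  omega

/-- **F-2124 — the schema `Prop31i_ringStructures'` is false as typed** ([IUTchIII] Prop. 3.1 (i),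
p. 93, typed at one finite level but — as a kernel constant — over ARBITRARY index types `A`, `Vfib` and
arbitrary fields `L α v`): at `𝕜 = ℚ`, `A = PUnit`, `Vfib = ℕ`, `L α v = ℚ` the tensor packet
`log(^A𝓕_{v_ℚ}) = ⊗_{PUnit} (ℕ → ℚ)` contains the pairwise distinct idempotents `⊗ δ_n` (`n : ℕ`), so it
is not ring-isomorphic to any FINITE product of fields (whose idempotents have all coordinates in
`{0, 1}`).  Instance form PROVED: `Prop31i_ringStructures'_of_field`.
[claim: Mochizuki2012, status: disputed] -/
theorem not_forall_prop31i_ringStructures' :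
    ¬ ∀ (𝕜 : Type) [Field 𝕜] (A Vfib : Type) (L : A → Vfib → Type)
        [∀ α v, Field (L α v)] [∀ α v, Algebra 𝕜 (L α v)], Prop31i_ringStructures' 𝕜 L := by
  intro h
  obtain ⟨ι, hι, K, hK, ⟨e⟩⟩ := h ℚ PUnit ℕ (fun _ _ => ℚ)
  -- the idempotents `u n := ⊗_{PUnit} δ_n` of the packet `⊗_{PUnit} (ℕ → ℚ)`
  let u : ℕ → PacketN ℚ (fun (_ : PUnit) (_ : ℕ) => ℚ) :=
    fun n => tprod ℚ fun _ : PUnit => (Pi.single n (1 : ℚ) : ℕ → ℚ)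
  have hu_idem : ∀ n, u n * u n = u n := by
    intro n
    simp only [u, tprod_mul_tprod]
    congr 1
    funext a
    rw [Pi.mul_def]
    funext k
    rcases eq_or_ne k n with rfl | hk
    · simp
    · simp [hk]
  have hu_inj : Function.Injective u := by
    intro n m hnm
    have h1 := congrArg (PiTensorProduct.subsingletonEquiv (R := ℚ) PUnit.unit) hnm
    simp only [u, PiTensorProduct.subsingletonEquiv_apply_tprod] at h1
    by_contra hne
    have h2 := congrFun h1 n
    simp [hne] at h2
  -- every coordinate of the image of an idempotent in a product of fields is `0` or `1`
  have h01 : ∀ n i, e (u n) i = 0 ∨ e (u n) i = 1 := by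
    intro n i
    have hsq : e (u n) i * e (u n) i = e (u n) i := by
      rw [← Pi.mul_apply, ← map_mul, hu_idem]
    rcases eq_or_ne (e (u n) i) 0 with h0 | h0
    · exact Or.inl h0
    · exact Or.inr (mul_left_cancel₀ h0 (by rw [hsq, mul_one]))
  -- hence `n ↦ (i ↦ [e (u n) i = 1])` is an injection of `ℕ` into the finite type `ι → Prop`
  let g : ℕ → ι → Prop := fun n i => e (u n) i = 1
  have hg : Function.Injective g := by
    intro n m hnm
    apply hu_inj
    apply e.injective
    funext i
    have hi : e (u n) i = 1 ↔ e (u m) i = 1 := Iff.of_eq (congrFun hnm i)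
    rcases h01 n i with h0 | h1 <;> rcases h01 m i with h0' | h1'
    · rw [h0, h0']
    · exact absurd ((hi.mpr h1').symm.trans h0) one_ne_zero
    · exact absurd ((hi.mp h1).symm.trans h0') one_ne_zero
    · rw [h1, h1']
  haveI : Finite ℕ := Finite.of_injective g hg
  exact not_finite ℕ

end Literature.IUT.LogThetaLattice
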